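import Summits.ResolutionOfSingularities.ResolutionOfSingularities.Theorems.WildConesCampaignW46HypersurfacesCharTwoFourfoldImperfectLeaf
import Mathlib.FieldTheory.RatFunc.Degree

/-!
# [OURS · L1 W4.6, rung (ii) at p = 2, HONEST SCOPE MARKER, n = 4] PERFECTNESS IS NEEDED FOR THE SATELLITE: over an
# IMPERFECT field of characteristic 2 the multiple-tangent class `(e, h₂) = (2, 2)` has a THIRD census branch — the
# order-2-cleaned fourfold double point `z² = u₀u₁ + u₂³ + t·u₂u₃² + u₃⁵` (`t` a non-square) has EXACTLY ONE
# infinitely-near double point, the null polar `[e₃]`, and it is FREE: NO satellite (it would be `[√t : 1]`)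

HONEST FRAMING. Everything here is OURS: an explicit computation in route WildCones' TYPED point-blow-up dynamics
(`Theorems/WildConesClassicalRegimesDefs.lean`), in the pattern of the seat's witnesses
`…HypersurfacesCharTwo{FourfoldMixed,HilbertWitness,FourfoldThreeTangents}.lean` (p507619, p517132, p560817). NOTHING here
is a statement of the manuscript [Hironaka2017]; no FACT-LIST premise; AI review is weaker than expert review. Cell
res-hironaka (LADDER-RESOLUTION rung L, D-0089), slot W4.6, seat res-L1-s46-pv-4 (gen 7); host route `WildCones`, crux
`ClassicalRegimes` (stmt-ResolutionOfSingularities-16884; proved). CAVEAT (as in every file of this seat): over a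
non-perfect field the «cleaning» and the translations `τ ∈ κⁿ` are the FORMAL dynamics of the route; a non-rational
closed point of the exceptional divisor (here the satellite, with residue field `κ(√t)`) is not visited by them.

WHY. Over a PERFECT field the `(2,2)` census is «exactly one satellite + at most one free point» (p538084, p549448,
census rev 2 `…HilbertTwoExactCount`); gen 7 showed over EVERY field that the null polar `[λ₀]` is a near point and is
THE free point unless it is the satellite (`…NullPolarNear`). Here the remaining possibility is INHABITED: for
`a = u₀u₁ + u₂³ + t·u₂u₃² + u₃⁵` the kernel of the polar form is `{v₀ = v₁ = 0}`, the polars there are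
`polar(λ, v) = λ₂(v₂² + t·v₃²)` (so `N = κe₃`, `h₂ = 2`), and the tangent cubic is `w₂(w₂² + t·w₃²)`: if `t` is not
a square its only rational projective root on the kernel line is `[e₃] = N`, which is FREE (`polar(e₂, e₃) = t ≠ 0`).
So: exactly one infinitely-near double point, of corank `0` (isolated, `μ = 1`, nothing after it), and NO corank-`2`
successor — impossible over a perfect field. Non-vacuity over `𝔽₂(X)` with `t = X` (odd degree, not a square).

WHAT IS PROVED (`κ` any field of characteristic `2`, `t ∈ κ`, unless marked):

* (leaf lemmas — coefficients, `MultP`, `OrdP`, partials `(u₁, u₀, u₂² + t·u₃², u₃⁴)`, `𝔪⁵ ≤ (∂a)`, polar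
  matrix with kernel `{v₀ = v₁ = 0}`, polars `λ₂(v₂² + t v₃²)`, tangent cubic `w₂³ + t·w₂w₃²` — are in
  `…FourfoldImperfectLeaf.lean`);
* `fourImp_invariants` — `MultP`, `OrdP`, `Isol`, `e = 2`, `h₂ = 2`;
* `fourImp_multP_step_iff` — a chart/translation has a double successor iff its near vector `w` has
  `w₀ = w₁ = 0` and `w₂³ + t·w₂w₃² = 0`;
* `fourImp_census_of_not_square` — **`t` not a square ⇒ `[e₃]` is a double successor of corank `0` (isolated,
  `μ = 1`, nothing after) and EVERY double successor has near vector `e₃` and corank `0`: exactly one near point, free,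
  no satellite**; `fourfold_imperfect_witness_ratFunc` — the instance `κ = 𝔽₂(X)`, `t = X`.

References: [GreuelPfister2026] (context); [CasasAlvero2000] §3 (names free/satellite: context); [Hironaka2017]
Th. 16.6 p.84 — role replaced only, under adjudication; nothing of it is used.
-/

noncomputable section

-- single-problem summit: the doubled namespace component `ResolutionOfSingularities` is forced
set_option linter.dupNamespace false

open scoped BigOperators Classical

open MvPowerSeries IsLocalRing

open Literature.AlgebraicGeometry.Resolution

namespace Summit.ResolutionOfSingularities.ResolutionOfSingularities.Theorems

namespace CampaignW46.HypersurfacesCharTwo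

open WildCones WildCones.MuDropCharTwoOrdP ThreefoldsCharTwo

variable {κ : Type} [Field κ]

/-! ## The invariants: an order-2-cleaned isolated `(2,2)` state -/

/-- [OURS · L1 W4.6 rung (ii) at `p = 2`, `n = 4`; NOT a statement of the manuscript] **`u₀u₁ + u₂³ + t·u₂u₃² + u₃⁵`
is an order-2-cleaned isolated MULTIPLE-TANGENT double state**: `MultP`, `OrdP`, `Isol`, `e = 2`, `h₂ = 2`, over every
field of characteristic `2` and for every `t` (null-polar line `N = κe₃`, `polar(e₂, e₂) = 1 ≠ 0`; p542945's
criterion `h₂ = 2 ⟺ N is a line`). [folklore] -/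
theorem fourImp_invariants [CharP κ 2] {t : κ} {c : (Fin 4 → ℕ) → κ}
    (hc : ser 2 4 κ c = X 0 * X 1 + X 2 ^ 3 + t • (X 2 * X 3 ^ 2) + X 3 ^ 5) :
    MultP 2 4 κ c ∧ OrdP 2 4 κ c ∧ Isol 2 4 κ c ∧ milnorEmbDim 2 4 κ c = 2 ∧ milnorHilbertTwo 2 4 κ c = 2 := by
  have hM := multP_of_ser_eq_fourImp hc
  have hO := ordP_of_ser_eq_fourImp hc
  have hI := isol_of_ser_eq_fourImp hc
  have hker : ∀ v : Fin 4 → κ, Matrix.vecMul v (polarMatrix (ser 2 4 κ c)) = 0 ↔ v 0 = 0 ∧ v 1 = 0 := by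
    intro v; rw [hc]; exact vecMul_polarMatrix_fourImp_eq_zero_iff t v
  -- `e = 2`: `e ≤ 2` by `OrdP`, `e ≥ 2` since `e₂, e₃` span a plane inside the kernel
  have hle : milnorEmbDim 2 4 κ c ≤ 2 := by
    have := (ordP_iff_milnorEmbDim_add_two_le hM).mp hO
    omega
  have hge : 2 ≤ milnorEmbDim 2 4 κ c := by
    set K := LinearMap.ker (polarMatrix (ser 2 4 κ c)).mulVecLin with hK
    have hfr : Module.finrank κ K = milnorEmbDim 2 4 κ c := by rw [hK, finrank_ker_polarMatrix hM]
    have hmem : ∀ v : Fin 4 → κ, v 0 = 0 → v 1 = 0 → v ∈ K := by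
      intro v h0 h1
      rw [hK, mem_ker_polarMatrix_iff, hker]
      exact ⟨h0, h1⟩
    have h2K : (Pi.single 2 1 : Fin 4 → κ) ∈ K := hmem _ (by simp) (by simp)
    have h3K : (Pi.single 3 1 : Fin 4 → κ) ∈ K := hmem _ (by simp) (by simp)
    have h20 : (Pi.single 2 1 : Fin 4 → κ) ≠ 0 := fun h => by
      have := congrFun h 2; simp at this
    have hL : (κ ∙ (Pi.single 2 1 : Fin 4 → κ)) < K := by
      refine lt_of_le_of_ne ((Submodule.span_singleton_le_iff_mem _ K).mpr h2K) (fun hEq => ?_)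
      have h3L : (Pi.single 3 1 : Fin 4 → κ) ∈ (κ ∙ (Pi.single 2 1 : Fin 4 → κ)) := by rw [hEq]; exact h3K
      obtain ⟨r, hr⟩ := Submodule.mem_span_singleton.mp h3L
      have := congrFun hr 3
      simp at this
    haveI : FiniteDimensional κ K := FiniteDimensional.finiteDimensional_submodule K
    have hlt := Submodule.finrank_lt_finrank_of_lt hL
    rw [finrank_span_singleton h20] at hlt
    omega
  have he : milnorEmbDim 2 4 κ c = 2 := le_antisymm hle hge
  have hpol : ∀ lam v : Fin 4 → κ,
      ∑ s, lam s * degForm 2 (MvPowerSeries.pderiv s (ser 2 4 κ c)) v = lam 2 * (v 2 ^ 2 + t * v 3 ^ 2) := by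
    intro lam v; rw [hc, polar_fourImp]
  -- `h₂ = 2`: the null polars form the line `κe₃`
  have hh : milnorHilbertTwo 2 4 κ c = 2 := by
    refine (hypersurface_milnorHilbertTwo_eq_two_iff_null_polar_line c hM he).mpr ⟨⟨Pi.single 3 1, ?_, ?_, ?_⟩,
      ⟨Pi.single 2 1, Pi.single 2 1, ?_, ?_, ?_⟩⟩
    · intro h; have := congrFun h 3; simp at this
    · exact (hker _).mpr ⟨by simp, by simp⟩
    · intro v _; rw [hpol]; simp
    · exact (hker _).mpr ⟨by simp, by simp⟩
    · exact (hker _).mpr ⟨by simp, by simp⟩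
    · rw [hpol]; simp
  exact ⟨hM, hO, hI, he, hh⟩

/-! ## The near points: only the null polar `[e₃]`, and it is free -/

/-- [OURS · L1 W4.6 rung (ii) at `p = 2`, `n = 4`; NOT a statement of the manuscript] **THE NEAR-POINT EQUATION**: a
chart `i` and a translation `τ` give a double successor of `u₀u₁ + u₂³ + t·u₂u₃² + u₃⁵` iff the near vector
`w = (τ with w_i = 1)` satisfies `w₀ = w₁ = 0` and `w₂³ + t·w₂w₃² = 0` (p524988 with the kernel and the cubic of
this file). [folklore] -/
theorem fourImp_multP_step_iff [CharP κ 2] {t : κ} {c : (Fin 4 → ℕ) → κ}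
    (hc : ser 2 4 κ c = X 0 * X 1 + X 2 ^ 3 + t • (X 2 * X 3 ^ 2) + X 3 ^ 5) (i : Fin 4) (τ : Fin 4 → κ) :
    MultP 2 4 κ (step 2 4 κ i τ c) ↔
      Function.update τ i 1 0 = 0 ∧ Function.update τ i 1 1 = 0 ∧
        Function.update τ i 1 2 ^ 3 + t * (Function.update τ i 1 2 * Function.update τ i 1 3 ^ 2) = 0 := by
  obtain ⟨hM, -, hI, -⟩ := fourImp_invariants hc
  rw [hypersurface_multP_step_iff c i τ hM hI, hc, vecMul_polarMatrix_fourImp_eq_zero_iff, degForm_three_fourImp,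
    and_assoc]

/-- [OURS · L1 W4.6 rung (ii) at `p = 2`, `n = 4`, IMPERFECT field; NOT a statement of the manuscript] **THE THIRD
BRANCH OF THE `(2,2)` CENSUS: exactly one infinitely-near double point, and it is FREE.** If `t ∈ κ` is NOT a square
(so `κ` is imperfect), then for the order-2-cleaned isolated `(e, h₂) = (2, 2)` double state
`u₀u₁ + u₂³ + t·u₂u₃² + u₃⁵`: (1) chart `3` at the origin (near vector `e₃`, the null polar) has a double successor
of corank `0` — isolated, `μ = 1`, no double point after it; (2) EVERY chart/translation with a double successor has
near vector exactly `e₃` and a corank-`0` successor. In particular NO double successor of corank `2` exists: the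
satellite `[√t : 1 ]` of the kernel cubic `w₂(w₂² + t w₃²)` is not rational — over a perfect field this cannot happen
(p538084: at `h₂ = 2` a satellite successor always exists). [folklore] -/
theorem fourImp_census_of_not_square [CharP κ 2] {t : κ} (ht : ∀ s : κ, s ^ 2 ≠ t) {c : (Fin 4 → ℕ) → κ}
    (hc : ser 2 4 κ c = X 0 * X 1 + X 2 ^ 3 + t • (X 2 * X 3 ^ 2) + X 3 ^ 5) :
    (MultP 2 4 κ (step 2 4 κ 3 0 c) ∧ milnorEmbDim 2 4 κ (step 2 4 κ 3 0 c) = 0 ∧ Isol 2 4 κ (step 2 4 κ 3 0 c) ∧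
        mu 2 4 κ (step 2 4 κ 3 0 c) = 1 ∧
        ∀ (i' : Fin 4) (τ' : Fin 4 → κ), ¬ MultP 2 4 κ (step 2 4 κ i' τ' (step 2 4 κ 3 0 c))) ∧
      ∀ (i : Fin 4) (τ : Fin 4 → κ), MultP 2 4 κ (step 2 4 κ i τ c) →
        Function.update τ i 1 = Pi.single 3 1 ∧ milnorEmbDim 2 4 κ (step 2 4 κ i τ c) = 0 := by
  obtain ⟨hM, -, hI, he, -⟩ := fourImp_invariants hc
  have ht0 : t ≠ 0 := fun h => ht 0 (by rw [h]; ring)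
  have hker : ∀ v : Fin 4 → κ, Matrix.vecMul v (polarMatrix (ser 2 4 κ c)) = 0 ↔ v 0 = 0 ∧ v 1 = 0 := by
    intro v; rw [hc]; exact vecMul_polarMatrix_fourImp_eq_zero_iff t v
  have hpol : ∀ lam v : Fin 4 → κ,
      ∑ s, lam s * degForm 2 (MvPowerSeries.pderiv s (ser 2 4 κ c)) v = lam 2 * (v 2 ^ 2 + t * v 3 ^ 2) := by
    intro lam v; rw [hc, polar_fourImp]
  -- every near vector is `e₃`
  have hnear : ∀ (i : Fin 4) (τ : Fin 4 → κ), MultP 2 4 κ (step 2 4 κ i τ c) →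
      Function.update τ i 1 = Pi.single 3 1 := by
    intro i τ hM'
    obtain ⟨h0, h1, hcub⟩ := (fourImp_multP_step_iff hc i τ).mp hM'
    set w := Function.update τ i 1 with hw
    have h2 : w 2 = 0 := by
      by_contra h2
      have hq : w 2 ^ 2 + t * w 3 ^ 2 = 0 := by
        have : w 2 * (w 2 ^ 2 + t * w 3 ^ 2) = 0 := by rw [← hcub]; ring
        exact (mul_eq_zero.mp this).resolve_left h2
      by_cases h3 : w 3 = 0
      · rw [h3, zero_pow two_ne_zero, mul_zero, add_zero] at hq
        exact h2 (pow_eq_zero_iff two_ne_zero |>.mp hq)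
      · apply ht (w 2 / w 3)
        rw [div_pow, div_eq_iff (pow_ne_zero 2 h3), eq_neg_of_add_eq_zero_left hq, CharTwo.neg_eq]
    have hi : w i = 1 := Function.update_self ..
    have hi3 : i = 3 := by
      fin_cases i
      · exact absurd (h0.symm.trans hi) zero_ne_one
      · exact absurd (h1.symm.trans hi) zero_ne_one
      · exact absurd (h2.symm.trans hi) zero_ne_one
      · rfl
    subst hi3
    funext s
    fin_cases s
    · simpa using h0
    · simpa using h1
    · simpa using h2
    · simpa using hi
  -- the free successor at `e₃`
  have hfree : ∀ (i : Fin 4) (τ : Fin 4 → κ), MultP 2 4 κ (step 2 4 κ i τ c) →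
      milnorEmbDim 2 4 κ (step 2 4 κ i τ c) = 0 := by
    intro i τ hM'
    refine (hypersurface_milnorEmbDim_step_eq_zero_iff c i τ hM he hM').mpr ⟨Pi.single 2 1, ?_, ?_⟩
    · exact (hker _).mpr ⟨by simp, by simp⟩
    · rw [hpol, hnear i τ hM']; simpa using ht0
  have hM₃ : MultP 2 4 κ (step 2 4 κ 3 0 c) := by
    refine (fourImp_multP_step_iff hc 3 0).mpr ⟨by simp, by simp, ?_⟩
    simp
  have he₃ := hfree 3 0 hM₃
  obtain ⟨v, hv, hne⟩ := (hypersurface_milnorEmbDim_step_eq_zero_iff c 3 0 hM he hM₃).mp he₃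
  obtain ⟨hI₃, hμ₃, hno⟩ := hypersurface_simple_tangent_resolved c 3 0 hM he hM₃ hv hne
  exact ⟨⟨hM₃, he₃, hI₃, hμ₃, hno⟩, fun i τ hM' => ⟨hnear i τ hM', hfree i τ hM'⟩⟩

/-- [OURS · L1 W4.6 rung (ii) at `p = 2`, `n = 4`, HONEST SCOPE MARKER; NOT a statement of the manuscript]
**PERFECTNESS IS NEEDED FOR THE SATELLITE**: over the imperfect field `𝔽₂(X)` of characteristic `2` there is an
order-2-cleaned ISOLATED fourfold double state with `e = 2`, `h₂ = 2` (`z² = u₀u₁ + u₂³ + X·u₂u₃² + u₃⁵`) with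
EXACTLY ONE infinitely-near double point — near vector `e₃`, successor of corank `0`, isolated, `μ = 1`, nothing
after — and NO corank-`2` (satellite) successor: the `(2,2)` census line «exactly one satellite» of
`…HilbertTwoExactCount` / p538084 does not survive dropping `PerfectField`. [folklore] -/
theorem fourfold_imperfect_witness_ratFunc :
    ∃ c : (Fin 4 → ℕ) → RatFunc (ZMod 2), MultP 2 4 (RatFunc (ZMod 2)) c ∧ OrdP 2 4 (RatFunc (ZMod 2)) c ∧
      Isol 2 4 (RatFunc (ZMod 2)) c ∧ milnorEmbDim 2 4 (RatFunc (ZMod 2)) c = 2 ∧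
      milnorHilbertTwo 2 4 (RatFunc (ZMod 2)) c = 2 ∧
      (MultP 2 4 (RatFunc (ZMod 2)) (step 2 4 (RatFunc (ZMod 2)) 3 0 c) ∧
        milnorEmbDim 2 4 (RatFunc (ZMod 2)) (step 2 4 (RatFunc (ZMod 2)) 3 0 c) = 0 ∧
        Isol 2 4 (RatFunc (ZMod 2)) (step 2 4 (RatFunc (ZMod 2)) 3 0 c) ∧
        mu 2 4 (RatFunc (ZMod 2)) (step 2 4 (RatFunc (ZMod 2)) 3 0 c) = 1 ∧
        ∀ (i' : Fin 4) (τ' : Fin 4 → RatFunc (ZMod 2)),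
          ¬ MultP 2 4 (RatFunc (ZMod 2)) (step 2 4 (RatFunc (ZMod 2)) i' τ' (step 2 4 (RatFunc (ZMod 2)) 3 0 c))) ∧
      ∀ (i : Fin 4) (τ : Fin 4 → RatFunc (ZMod 2)), MultP 2 4 (RatFunc (ZMod 2)) (step 2 4 (RatFunc (ZMod 2)) i τ c) →
        Function.update τ i 1 = Pi.single 3 1 ∧ milnorEmbDim 2 4 (RatFunc (ZMod 2)) (step 2 4 (RatFunc (ZMod 2)) i τ c) = 0 := by
  have hX : ∀ s : RatFunc (ZMod 2), s ^ 2 ≠ RatFunc.X := by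
    intro s hs
    have hs0 : s ≠ 0 := by
      rintro rfl
      rw [zero_pow two_ne_zero] at hs
      exact RatFunc.X_ne_zero hs.symm
    have hdeg := congrArg RatFunc.intDegree hs
    rw [pow_two, RatFunc.intDegree_mul hs0 hs0, RatFunc.intDegree_X] at hdeg
    omega
  obtain ⟨c, hc⟩ := exists_ser_eq
    (X 0 * X 1 + X 2 ^ 3 + RatFunc.X • (X 2 * X 3 ^ 2) + X 3 ^ 5 : MvPowerSeries (Fin 4) (RatFunc (ZMod 2)))
    (fourImp_coeff_eq_zero_of_even RatFunc.X)
  obtain ⟨hM, hO, hI, he, hh⟩ := fourImp_invariants hc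
  obtain ⟨h3, hall⟩ := fourImp_census_of_not_square hX hc
  exact ⟨c, hM, hO, hI, he, hh, h3, hall⟩

end CampaignW46.HypersurfacesCharTwo

end Summit.ResolutionOfSingularities.ResolutionOfSingularities.Theorems

end
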